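import Mathlib
import Literature.Combinatorics.Additive.RestrictedSumsetsInRootsOfUnityBound
import Summits.KontsevichZagierPeriods.Zeta5Search.UniversalDigitCells
import HarnessLib

/-!
# ζ(5) search — the residue theorem over `𝔽_p` in product form, and the reduction of `p`-integral rationals to `ZMod p`
# (tools for gen-2 g9's MOMENT LEMMA `GHatMoments`, part 1 of 2)

Cell `pub-zeta5` (HONEST FRAMING: systematic search; no irrationality claim unless certified), typer seat generation 10.
Two self-contained tools for the proof of `GHatMoments` (`Zeta5Search/UniversalDigitCells.lean` §5, REPORT-gen2-g9 §6.1), which is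
assembled in part 2 (`GHatMomentsProof.lean`):

* §A `sum_pow_mul_prod_zpow_eq_zero` — **the residue theorem over a finite field `F`, in product form**: for `E : F → ℤ` bounded below by
  `−N` (`N ≥ 1`) with `i + Σ_w (E(w) + N − 1) ≤ −2`, the "deep" points `D = {x : E(x) = −N}` satisfy
  `Σ_{x ∈ D} x^i · ∏_{w ≠ x} (w − x)^{E(w)} = 0`.  Proof: with `P = X^i ∏_{w ∉ D} (w − X)^{E(w)+N−1}` (a polynomial of degree
  `≤ |D| − 2` by the hypothesis) the Lagrange top-coefficient identity `Σ_{x ∈ D} P(x)/∏_{y ∈ D∖x}(x − y) = 0` (tree: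
  `Literature.Combinatorics.Additive.Yip.sum_nodalWeight_mul_eval_eq_zero`) is, term by term, `(−1)^{|D|−1} K^{N−1}` times the displayed
  sum, `K = ∏_{u ≠ 0} u` (`= −1` by Wilson, not needed).
* §B (namespace `PInt`) the closure properties of `p`-integrality `p ∤ den r`, the compatibility of `Rat.cast : ℚ → ZMod p` with `+, −, ·, Σ, ∏` and with
  integer powers of integers prime to `p` on `p`-integral rationals (`Rat.cast_add_of_ne_zero` & co.), and the criterion
  `pCong_of_cast_eq_zero`: a `p`-integral rational whose image in `ZMod p` vanishes is `≡ 0 (mod p)` in the sense of `pCong`.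

Pure algebra; nothing here bears on irrationality.
-/

open Finset

namespace Summit.KontsevichZagierPeriods.Zeta5Search.ClusterValuation

/-! ## §A  The residue theorem over a finite field, product form -/

section Residue

variable {F : Type*} [Field F]

/-- `∏_{i ∈ s} a^{f i} = a^{Σ_{i ∈ s} f i}` for `a ≠ 0` and integer exponents. -/
theorem prod_zpow_eq_zpow_sum {ι : Type*} (s : Finset ι) {a : F} (ha : a ≠ 0) (f : ι → ℤ) :
    ∏ i ∈ s, a ^ f i = a ^ ∑ i ∈ s, f i := by
  induction s using Finset.cons_induction with
  | empty => simp
  | cons j s hj ih => rw [prod_cons, sum_cons, ih, zpow_add₀ ha]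

variable [Fintype F] [DecidableEq F]

open Polynomial in
/-- **Residue theorem over a finite field, product form.**  Let `E : F → ℤ` with `−N ≤ E(w)` for all `w` (`N ≥ 1`) and
`i + Σ_w (E(w) + N − 1) ≤ −2`.  Then `Σ_{x : E(x) = −N} x^i ∏_{w ≠ x} (w − x)^{E(w)} = 0`.
(The summands are the residues of `Y^i ∏_w (Y − w)^{E(w)+N−1} dY` up to the common unit `(−1)^{#D−1+…} K^{N−1}`; the hypothesis says
this differential has no pole at `∞`.) -/
theorem sum_pow_mul_prod_zpow_eq_zero (E : F → ℤ) (N i : ℕ) (hN : 1 ≤ N) (hE : ∀ w, -(N : ℤ) ≤ E w)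
    (hdeg : (i : ℤ) + ∑ w, (E w + N - 1) ≤ -2) :
    ∑ x ∈ univ.filter (fun x => E x = -(N : ℤ)), x ^ i * ∏ w ∈ univ.erase x, (w - x) ^ E w = 0 := by
  set D := univ.filter (fun x : F => E x = -(N : ℤ)) with hD
  have hmemD : ∀ {x}, x ∈ D ↔ E x = -(N : ℤ) := by intro x; simp [hD]
  have hm : ∀ w, w ∉ D → 0 ≤ E w + N - 1 := by
    intro w hw
    have h1 := hE w
    have h2 : E w ≠ -(N : ℤ) := fun h => hw (hmemD.2 h)
    omega
  -- the constant `K = ∏_{u ≠ 0} u` and its translates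
  set K : F := ∏ u ∈ univ.erase (0 : F), u with hK
  have hK0 : K ≠ 0 := prod_ne_zero_iff.2 fun u hu => (mem_erase.1 hu).1
  have hKx : ∀ x : F, ∏ w ∈ univ.erase x, (w - x) = K := by
    intro x
    refine prod_nbij' (fun w => w - x) (fun u => u + x) ?_ ?_ ?_ ?_ ?_
    · intro w hw
      exact mem_erase.2 ⟨sub_ne_zero.2 (mem_erase.1 (mem_coe.1 hw)).1, mem_univ _⟩
    · intro u hu
      refine mem_erase.2 ⟨?_, mem_univ _⟩
      intro h
      exact (mem_erase.1 (mem_coe.1 hu)).1 (by simpa using h)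
    · intro w _; simp
    · intro u _; simp
    · intro w _; rfl
  -- the auxiliary polynomial
  set P : F[X] := X ^ i * ∏ w ∈ Dᶜ, (C w - X) ^ (E w + N - 1).toNat with hP
  have hPdeg : P.natDegree ≤ i + ∑ w ∈ Dᶜ, (E w + N - 1).toNat := by
    refine natDegree_mul_le.trans ?_
    rw [natDegree_X_pow]
    refine Nat.add_le_add_left ((natDegree_prod_le _ _).trans (sum_le_sum fun w _ => ?_)) _
    have h1 : (C w - X : F[X]).natDegree ≤ 1 := (natDegree_sub_le _ _).trans (max_le (by simp) natDegree_X_le)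
    calc ((C w - X) ^ (E w + N - 1).toNat : F[X]).natDegree
        ≤ (E w + N - 1).toNat * (C w - X : F[X]).natDegree := natDegree_pow_le
      _ ≤ (E w + N - 1).toNat * 1 := Nat.mul_le_mul_left _ h1
      _ = _ := mul_one _
  have hcard : P.natDegree + 1 < D.card := by
    have hsplit : ∑ w ∈ D, (E w + N - 1) + ∑ w ∈ Dᶜ, (E w + N - 1) = ∑ w, (E w + N - 1) :=
      sum_add_sum_compl D _
    have hDsum : ∑ w ∈ D, (E w + N - 1) = ∑ w ∈ D, (-1 : ℤ) :=
      sum_congr rfl fun w hw => by rw [hmemD.1 hw]; ring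
    rw [sum_const, smul_neg, nsmul_eq_mul, mul_one] at hDsum
    have htoNat : (∑ w ∈ Dᶜ, ((E w + N - 1).toNat : ℤ)) = ∑ w ∈ Dᶜ, (E w + N - 1) :=
      sum_congr rfl fun w hw => Int.toNat_of_nonneg (hm w (mem_compl.1 hw))
    have h1 : (P.natDegree : ℤ) ≤ i + ∑ w ∈ Dᶜ, ((E w + N - 1).toNat : ℤ) := by exact_mod_cast hPdeg
    rw [htoNat] at h1
    have : (P.natDegree : ℤ) + 1 < D.card := by linarith
    exact_mod_cast this
  have hres := Literature.Combinatorics.Additive.Yip.sum_nodalWeight_mul_eval_eq_zero D P hcard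
  -- termwise: nodal weight × value = (−1)^{#D−1} K^{N−1} × the displayed summand
  have hterm : ∀ x ∈ D, Lagrange.nodalWeight D id x * P.eval x =
      ((-1) ^ (D.card - 1) * K ^ (N - 1)) * (x ^ i * ∏ w ∈ univ.erase x, (w - x) ^ E w) := by
    intro x hx
    have hwx : ∀ w ∈ univ.erase x, w - x ≠ 0 := fun w hw => sub_ne_zero.2 (mem_erase.1 hw).1
    have hnw : Lagrange.nodalWeight D id x =
        (-1) ^ (D.card - 1) * ∏ y ∈ D.erase x, (y - x) ^ (E y + N - 1) := by
      simp only [Lagrange.nodalWeight, id]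
      rw [← card_erase_of_mem hx, ← prod_const, ← prod_mul_distrib]
      refine prod_congr rfl fun y hy => ?_
      rw [hmemD.1 (mem_of_mem_erase hy), show (-(N : ℤ) + N - 1) = -1 by ring, zpow_neg_one, ← neg_sub, inv_neg]
      ring
    have hPx : P.eval x = x ^ i * ∏ w ∈ Dᶜ, (w - x) ^ (E w + N - 1) := by
      simp only [hP, eval_mul, eval_pow, eval_X, eval_prod, eval_sub, eval_C]
      congr 1
      refine prod_congr rfl fun w hw => ?_
      rw [← zpow_natCast, Int.toNat_of_nonneg (hm w (mem_compl.1 hw))]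
    have hunion : univ.erase x = D.erase x ∪ Dᶜ := by
      ext w
      simp only [mem_erase, mem_univ, mem_union, mem_compl, and_true]
      constructor
      · intro hw
        by_cases hwD : w ∈ D
        · exact Or.inl ⟨hw, hwD⟩
        · exact Or.inr hwD
      · rintro (⟨hw, -⟩ | hw)
        · exact hw
        · rintro rfl; exact hw hx
    have hdisj : Disjoint (D.erase x) Dᶜ :=
      disjoint_left.2 fun w hw hw' => mem_compl.1 hw' (mem_of_mem_erase hw)
    have hprodf : ∏ w ∈ univ.erase x, (w - x) ^ (E w + N - 1) =
        (∏ w ∈ univ.erase x, (w - x) ^ E w) * K ^ (N - 1) := by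
      rw [← hKx x, ← prod_pow, ← prod_mul_distrib]
      refine prod_congr rfl fun w hw => ?_
      rw [← zpow_natCast, ← zpow_add₀ (hwx w hw)]
      congr 1
      omega
    rw [hnw, hPx]
    calc (-1) ^ (D.card - 1) * (∏ y ∈ D.erase x, (y - x) ^ (E y + N - 1)) *
          (x ^ i * ∏ w ∈ Dᶜ, (w - x) ^ (E w + N - 1))
        = (-1) ^ (D.card - 1) * x ^ i * ∏ w ∈ univ.erase x, (w - x) ^ (E w + N - 1) := by
          rw [hunion, prod_union hdisj]; ring
      _ = _ := by rw [hprodf]; ring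
  rw [sum_congr rfl hterm, ← mul_sum] at hres
  exact (mul_eq_zero.1 hres).resolve_left
    (mul_ne_zero (pow_ne_zero _ (neg_ne_zero.2 one_ne_zero)) (pow_ne_zero _ hK0))

end Residue

/-! ## §B  `p`-integral rationals (`p ∤ den`) and their images in `ZMod p` -/

section Bridge

variable {p : ℕ} [hp : Fact p.Prime]

namespace PInt

/-- The denominator of a `p`-integral rational is a unit of `ZMod p`. -/
theorem den_ne_zero {r : ℚ} (h : ¬ p ∣ r.den) : (r.den : ZMod p) ≠ 0 := by
  rwa [Ne, ZMod.natCast_eq_zero_iff]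

/-- Integers are `p`-integral. -/
theorem intCast (z : ℤ) : ¬ p ∣ (z : ℚ).den := by
  simp [Nat.dvd_one, hp.out.ne_one]

/-- `0` is `p`-integral. -/
theorem zero : ¬ p ∣ (0 : ℚ).den := by simpa using intCast (p := p) 0

/-- `1` is `p`-integral. -/
theorem one : ¬ p ∣ (1 : ℚ).den := by simpa using intCast (p := p) 1

/-- Sums of `p`-integral rationals are `p`-integral. -/
theorem add {q r : ℚ} (hq : ¬ p ∣ q.den) (hr : ¬ p ∣ r.den) : ¬ p ∣ (q + r).den := fun h =>
  (hp.out.dvd_mul.1 (h.trans (Rat.add_den_dvd q r))).elim hq hr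

/-- Products of `p`-integral rationals are `p`-integral. -/
theorem mul {q r : ℚ} (hq : ¬ p ∣ q.den) (hr : ¬ p ∣ r.den) : ¬ p ∣ (q * r).den := fun h =>
  (hp.out.dvd_mul.1 (h.trans (Rat.mul_den_dvd q r))).elim hq hr

omit hp in
/-- Negatives of `p`-integral rationals are `p`-integral. -/
theorem neg {q : ℚ} (hq : ¬ p ∣ q.den) : ¬ p ∣ (-q).den := by
  rwa [Rat.den_neg_eq_den]

/-- Differences of `p`-integral rationals are `p`-integral. -/
theorem sub {q r : ℚ} (hq : ¬ p ∣ q.den) (hr : ¬ p ∣ r.den) : ¬ p ∣ (q - r).den := by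
  rw [sub_eq_add_neg]; exact add hq (neg hr)

/-- Natural powers of `p`-integral rationals are `p`-integral. -/
theorem pow {q : ℚ} (hq : ¬ p ∣ q.den) (n : ℕ) : ¬ p ∣ (q ^ n).den := fun h =>
  hq (hp.out.dvd_of_dvd_pow (by rwa [Rat.den_pow] at h))

/-- Powers of naturals are `p`-integral (for `(n : ℚ)` itself this is the tree's
`Literature.NumberTheory.Automorphic.not_dvd_den_natCast`, not restated here). -/
theorem natCast_pow (n i : ℕ) : ¬ p ∣ ((n : ℚ) ^ i).den :=
  pow (by simpa using intCast (p := p) (n : ℤ)) i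

/-- Finite sums of `p`-integral rationals are `p`-integral. -/
theorem sum {ι : Type*} {s : Finset ι} {f : ι → ℚ} (h : ∀ i ∈ s, ¬ p ∣ (f i).den) :
    ¬ p ∣ (∑ i ∈ s, f i).den := by
  induction s using Finset.cons_induction with
  | empty => simpa using zero (p := p)
  | cons j s hj ih =>
    rw [sum_cons]
    exact add (h j (mem_cons_self _ _)) (ih fun i hi => h i (mem_cons_of_mem hi))

/-- Finite products of `p`-integral rationals are `p`-integral. -/
theorem prod {ι : Type*} {s : Finset ι} {f : ι → ℚ} (h : ∀ i ∈ s, ¬ p ∣ (f i).den) :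
    ¬ p ∣ (∏ i ∈ s, f i).den := by
  induction s using Finset.cons_induction with
  | empty => simpa using one (p := p)
  | cons j s hj ih =>
    rw [prod_cons]
    exact mul (h j (mem_cons_self _ _)) (ih fun i hi => h i (mem_cons_of_mem hi))

/-- The inverse of an integer prime to `p` is `p`-integral. -/
theorem inv_int {z : ℤ} (hz : ¬ (p : ℤ) ∣ z) : ¬ p ∣ ((z : ℚ)⁻¹).den := by
  rw [Rat.inv_intCast_den]
  split_ifs with h0
  · simp [Nat.dvd_one, hp.out.ne_one]
  · rwa [← Int.natCast_dvd]

/-- Integer powers of an integer prime to `p` are `p`-integral. -/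
theorem zpow_int {z : ℤ} (hz : ¬ (p : ℤ) ∣ z) (e : ℤ) : ¬ p ∣ ((z : ℚ) ^ e).den := by
  rcases Int.eq_nat_or_neg e with ⟨m, rfl | rfl⟩
  · rw [zpow_natCast]; exact pow (intCast z) m
  · rw [zpow_neg, zpow_natCast, ← Int.cast_pow]
    exact inv_int fun h => hz ((Nat.prime_iff_prime_int.1 hp.out).dvd_of_dvd_pow h)

/-- `Rat.cast` is additive on `p`-integral rationals. -/
theorem cast_add {q r : ℚ} (hq : ¬ p ∣ q.den) (hr : ¬ p ∣ r.den) :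
    ((q + r : ℚ) : ZMod p) = (q : ZMod p) + r :=
  Rat.cast_add_of_ne_zero (den_ne_zero hq) (den_ne_zero hr)

/-- `Rat.cast` is multiplicative on `p`-integral rationals. -/
theorem cast_mul {q r : ℚ} (hq : ¬ p ∣ q.den) (hr : ¬ p ∣ r.den) :
    ((q * r : ℚ) : ZMod p) = (q : ZMod p) * r :=
  Rat.cast_mul_of_ne_zero (den_ne_zero hq) (den_ne_zero hr)

/-- `Rat.cast` respects subtraction on `p`-integral rationals. -/
theorem cast_sub {q r : ℚ} (hq : ¬ p ∣ q.den) (hr : ¬ p ∣ r.den) :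
    ((q - r : ℚ) : ZMod p) = (q : ZMod p) - r :=
  Rat.cast_sub_of_ne_zero (den_ne_zero hq) (den_ne_zero hr)

/-- `Rat.cast` respects finite sums of `p`-integral rationals. -/
theorem cast_sum {ι : Type*} {s : Finset ι} {f : ι → ℚ} (h : ∀ i ∈ s, ¬ p ∣ (f i).den) :
    ((∑ i ∈ s, f i : ℚ) : ZMod p) = ∑ i ∈ s, (f i : ZMod p) := by
  induction s using Finset.cons_induction with
  | empty => simp
  | cons j s hj ih =>
    rw [sum_cons, sum_cons, cast_add (h j (mem_cons_self _ _)) (sum fun i hi => h i (mem_cons_of_mem hi)),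
      ih fun i hi => h i (mem_cons_of_mem hi)]

/-- `Rat.cast` respects finite products of `p`-integral rationals. -/
theorem cast_prod {ι : Type*} {s : Finset ι} {f : ι → ℚ} (h : ∀ i ∈ s, ¬ p ∣ (f i).den) :
    ((∏ i ∈ s, f i : ℚ) : ZMod p) = ∏ i ∈ s, (f i : ZMod p) := by
  induction s using Finset.cons_induction with
  | empty => simp
  | cons j s hj ih =>
    rw [prod_cons, prod_cons, cast_mul (h j (mem_cons_self _ _)) (prod fun i hi => h i (mem_cons_of_mem hi)),
      ih fun i hi => h i (mem_cons_of_mem hi)]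

/-- `Rat.cast` respects integer powers of an integer prime to `p`. -/
theorem cast_zpow_int {z : ℤ} (hz : ¬ (p : ℤ) ∣ z) (e : ℤ) :
    ((((z : ℚ) ^ e : ℚ)) : ZMod p) = (z : ZMod p) ^ e := by
  have hp' := Nat.prime_iff_prime_int.1 hp.out
  rcases Int.eq_nat_or_neg e with ⟨m, rfl | rfl⟩
  · rw [zpow_natCast, zpow_natCast, Rat.cast_pow, Rat.cast_intCast]
  · rw [zpow_neg, zpow_natCast, zpow_neg, zpow_natCast, ← Int.cast_pow, Rat.cast_inv_of_ne_zero, Rat.cast_intCast,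
      Int.cast_pow]
    rw [Rat.num_intCast, Ne, ZMod.intCast_zmod_eq_zero_iff_dvd]
    exact fun h => hz (hp'.dvd_of_dvd_pow h)

/-- **Criterion.**  A `p`-integral rational whose image in `ZMod p` vanishes is `≡ 0 (mod p)` (`pCong`). -/
theorem pCong_of_cast_eq_zero {r : ℚ} (hr : ¬ p ∣ r.den) (h0 : (r : ZMod p) = 0) : pCong p r = true := by
  rw [pCong, decide_eq_true_iff]
  rw [Rat.cast_def, div_eq_zero_iff] at h0
  rcases h0 with h0 | h0
  · rw [ZMod.intCast_zmod_eq_zero_iff_dvd] at h0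
    rcases (padicValInt_dvd_iff 1 r.num).1 (by rwa [pow_one]) with h | h
    · exact Or.inl (Rat.num_eq_zero.1 h)
    · right
      rw [padicValRat, padicValNat.eq_zero_of_not_dvd hr]
      push_cast
      linarith
  · exact absurd h0 (den_ne_zero hr)

end PInt

end Bridge

end Summit.KontsevichZagierPeriods.Zeta5Search.ClusterValuation
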